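import Summits.QuantumFields.YangMills.Theorems.AlphaInputsT3ACv3RegionalThm1Carrier
import HarnessLib

/-!
# `AlphaInputsT3ACv3RegionalThm1CarrierBridge` — B1 (n-3): THE ONE BRIDGE FROM THE REGIONAL CARRIER'S (2) TO THE B1 TEAM'S HYPOTHESIS CURRENCY — `RegOnT3 k h e U`
# (LQB's `InSpace` over the regions of `h`, through `SU(2) ≤ U(2)`) ⇒ the fine plaquettes with all corners in `Ω_j(h)` are `< e·L^{−2j}` (the `PlaqSmallOn (plaqsIn 0 (Ω_j h))`
# shape read by r-68a ✓p611785, r-68b ✓p612074, EDGES-A ✓p613254), and (3) ⇒ the top clause of `NestedRegularSelT3` — cell `ym3-torus`, crux stmt-QuantumFields-19936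
# (`HistoryTailL`, (O″χ) block B1), LEAD seat `ym-ust-19936-w1` (g3)

WHAT (def-free).  `AlphaInputsT3AC.plaqSmallOn_of_regOnT3` (clause 1 of (2): `plaqsIn ⊆ Touches`, `dist1_plaqHol_toUField`), `AlphaInputsT3AC.top_of_constraintOn` ((3) ⇒ exact `k`-fold
averages `𝓥 k` on `bondsIn k (Ω_k h)`, the shape of `NestedRegularSelT3`'s clause (3ᵗ)), and the member form `AlphaInputsT3AC.plaqSmallOn_of_mem_regFibreRegT3`.  So a configuration in the
regional regular fibre `regFibreRegT3 k h e 𝓥` at ONE radius `e` feeds the B1 rows at the CONSTANT radius family `α_i := e` — the honest single-level reading; the level-dependent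
radii of `NestedRegularSelT3` come from NESTING (EDGES-B), not from this bridge.
HONEST FRAMING.  Bookkeeping; nothing of [B10]∕[B11] asserted; the stub 2′χ, the crux and any gap are NOT claimed; count-neutral helper (`--supports stmt-QuantumFields-19936`).
YM₃ on the three-torus is rung R3 of the programme, NOT the Clay problem: nothing here bears on d = 4, infinite volume, or a mass gap.

References: T. Bałaban, Commun. Math. Phys. 102 (1985) 277–309 [Balaban1985Variational] ((2)–(3) p.278); Commun. Math. Phys. 102 (1985) 255–275 [Balaban1985UV3] ((42) p.266,
(68) p.273).
-/

set_option autoImplicit false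

noncomputable section

namespace Summit.QuantumFields.YangMills.Theorems

open Set
open scoped Matrix.Norms.L2Operator
open Literature.MathematicalPhysics.QuantumFieldTheory.Balaban1983to89
open Literature.MathematicalPhysics.QuantumFieldTheory.Balaban1983to89.T3ContinuumYM3Torus
open Literature.MathematicalPhysics.QuantumFieldTheory.Balaban1983to89.T3UnitLawDensityEML (ℰp)
open Literature.MathematicalPhysics.QuantumFieldTheory.Balaban1983to89.B10Eq27TorusAxialLog (toUField dist1_plaqHol_toUField)
open Literature.MathematicalPhysics.QuantumFieldTheory.Balaban1983to89.B10Eq68TorusRegularity (InSpace inSpace_iff touches_of_src_mem)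
open Literature.MathematicalPhysics.QuantumFieldTheory.Balaban1983to89.B10Eq38TorusDomains (plaqsIn mem_plaqsIn_iff cornerSet toFine toFine_zero)
open Literature.MathematicalPhysics.QuantumFieldTheory.Balaban1983to89.B10Eq42TorusConstraint (bondsIn lam42 lam42_self)
open Literature.MathematicalPhysics.QuantumFieldTheory.Balaban1985CMP102.Setting
open Summit.QuantumFields.Balaban3D.Carriers
open Summit.QuantumFields.Balaban3D.Proofs.Primitives (AlphaConsts)
open Summit.QuantumFields.YangMills.Theorems.RegionalVP

variable {F : T3Family} {𝔠 : AlphaConsts F.L (suGroupModel 2).N} {γ : ℝ} {hγ : 0 < γ} {hγ1 : γ ≤ (min 𝔠.gamma0 1) ^ 2} {K : ℕ}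

/-- **CLAUSE 1 OF (2) IN THE B1 TEAM'S CURRENCY**: `RegOnT3 k h e U` ⇒ every fine plaquette with all four corners in `Ω_j(h)`, `j ≤ k`, has `dist1 < e·L^{−2j}` (the `PlaqSmallOn (plaqsIn 0 …)`
hypothesis shape of r-68a∕r-68b∕EDGES-A at the constant radius family `α_i := e`). [cite: Balaban1985Variational, (2) p.278] -/
theorem AlphaInputsT3AC.plaqSmallOn_of_regOnT3 {k : ℕ} {h : Hist (F.P K) k} {e : ℝ} {U : GaugeField (F.P K) 0 (Matrix.specialUnitaryGroup (Fin 2) ℂ)}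
    (hU : AlphaInputsT3AC.RegOnT3 F 𝔠 γ hγ hγ1 K k h e U) {j : ℕ} (hj : j ≤ k) :
    PlaqSmallOn (↑(plaqsIn 0 (Omega 𝔠.lane.carrier.M₁ (rcolOf (T3Scales F γ hγ (hγ1.trans (sq_min_one_le _ 𝔠.gamma0_pos)) K) 𝔠.lane.carrier) k h j)) :
      Set (Plaq (F.P K) 0)) (e * (((F.L : ℝ) ^ j)⁻¹) ^ 2) U := by
  intro q hq
  have hq' : q ∈ plaqsIn 0 (Omega 𝔠.lane.carrier.M₁ (rcolOf (T3Scales F γ hγ (hγ1.trans (sq_min_one_le _ 𝔠.gamma0_pos)) K) 𝔠.lane.carrier) k h j) := hq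
  have hsrc : q.src ∈ Omega 𝔠.lane.carrier.M₁ (rcolOf (T3Scales F γ hγ (hγ1.trans (sq_min_one_le _ 𝔠.gamma0_pos)) K) 𝔠.lane.carrier) k h j :=
    (mem_plaqsIn_iff.mp hq') (by simp [cornerSet])
  have h2 := ((inSpace_iff (toUField U)).mp hU).1 j hj q (touches_of_src_mem hsrc)
  rw [dist1_plaqHol_toUField] at h2
  exact h2

/-- The same for a member of the regional regular fibre. [cite: Balaban1985Variational, (6) p.278, (8) p.279] -/
theorem AlphaInputsT3AC.plaqSmallOn_of_mem_regFibreRegT3 {k : ℕ} {h : Hist (F.P K) k} {e : ℝ} {𝓥 : (j : ℕ) → GaugeField (F.P K) j (Matrix.specialUnitaryGroup (Fin 2) ℂ)}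
    {U : GaugeField (F.P K) 0 (Matrix.specialUnitaryGroup (Fin 2) ℂ)} (hU : U ∈ AlphaInputsT3AC.regFibreRegT3 F 𝔠 γ hγ hγ1 K k h e 𝓥) {j : ℕ} (hj : j ≤ k) :
    PlaqSmallOn (↑(plaqsIn 0 (Omega 𝔠.lane.carrier.M₁ (rcolOf (T3Scales F γ hγ (hγ1.trans (sq_min_one_le _ 𝔠.gamma0_pos)) K) 𝔠.lane.carrier) k h j)) :
      Set (Plaq (F.P K) 0)) (e * (((F.L : ℝ) ^ j)⁻¹) ^ 2) U :=
  AlphaInputsT3AC.plaqSmallOn_of_regOnT3 hU.1 hj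

/-- **(3) ⇒ THE TOP CLAUSE (3ᵗ) OF `NestedRegularSelT3`**: exact `k`-fold `ℰp`-averages `𝓥 k` on the bonds of `Ω_k(h)` (`Λ_k(h) = Ω_k(h)`, `bondsIn ⊆ bondsOn`).
[cite: Balaban1985Variational, (3) p.278; Balaban1985UV3, (42) p.266] -/
theorem AlphaInputsT3AC.top_of_constraintOn {k : ℕ} {h : Hist (F.P K) k} {𝓥 : (j : ℕ) → GaugeField (F.P K) j (Matrix.specialUnitaryGroup (Fin 2) ℂ)}
    {U : GaugeField (F.P K) 0 (Matrix.specialUnitaryGroup (Fin 2) ℂ)}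
    (hU : ConstraintOn (fun i => BlockAveraging.blockAvg (P := F.P K) (j := i) ℰp) k
      (lam42 (Omega 𝔠.lane.carrier.M₁ (rcolOf (T3Scales F γ hγ (hγ1.trans (sq_min_one_le _ 𝔠.gamma0_pos)) K) 𝔠.lane.carrier) k h) k) 𝓥 U) :
    ∀ b : PBond (F.P K) k, b ∈ bondsIn k (Omega 𝔠.lane.carrier.M₁
        (rcolOf (T3Scales F γ hγ (hγ1.trans (sq_min_one_le _ 𝔠.gamma0_pos)) K) 𝔠.lane.carrier) k h k) →
      Averaging.iter (fun i => BlockAveraging.blockAvg (P := F.P K) (j := i) ℰp) k U b = 𝓥 k b :=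
  AlphaInputsT3AC.top42Set_of_constraintOn (hγ1 := hγ1) hU

end Summit.QuantumFields.YangMills.Theorems

end
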